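import Mathlib.Analysis.Complex.Tietze
import Literature.Probability.RandomPlanarGeometry.RestrictionPullback
import Literature.Probability.RandomPlanarGeometry.ImageUnivalent
import Literature.Probability.RandomPlanarGeometry.CaratheodoryHalfPlaneProofs
import Literature.Probability.RandomPlanarGeometry.ConformalMapCaratheodoryProofs
import Literature.Probability.RandomPlanarGeometry.ConformalRestrictionProofs
import HarnessLib

/-!
# Transport of a law on chordal curves of the unit disc to a chordal family

Helper file (`--supports`) for item `stmt-CriticalPhenomena-7559` (`DiscRestrictionIsSLE`) of route
`SAWPoincareChain` of `CriticalPhenomena/SAWScalingLimit`: Lawler–Schramm–Werner's p. 5 result 2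
(J. Amer. Math. Soc. 16 (2003); in the tree `LawlerSchrammWerner2003_unique_holds`) is stated for
chordal FAMILIES, while the item is about ONE law `μ` on curves of the closed unit disc. This file
transports `μ` to a family `D ↦ (G_D)_* μ` along Carathéodory transport data and proves the
bookkeeping:

* `exists_transportData` — for every Dobrushin domain `(D; a, b)` a conformal `g : 𝔻 → D` with
  boundary values `1 ↦ a`, `-1 ↦ b` and a continuous plane map `G` agreeing with `g` on `𝔻`,
  injective on the closed disc (the tree's `exists_continuousMap_conj`: Riemann mapping,
  Carathéodory, Tietze);
* `exists_inverse` — `G` is a homeomorphism of the closed disc onto `closure D`; its inverse `Θ`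
  agrees with `g⁻¹` on `D`;
* `isChordal_transport`, `isCarriedBySimpleCurves_transport` — the transported family is chordal
  and carried by simple curves meeting `∂D` only at `a`, `b`;
* `isConformallyCovariant_transport` — it is conformally covariant as soon as `μ` is invariant
  under the automorphisms of `(𝔻; 1, -1)` (pushed along continuous extensions, which exist:
  `exists_continuousMap_eqOn_automorphism`).

The hull-restriction property and the identification with SLE_{8/3} are in the sibling files.
Sources: G. F. Lawler, O. Schramm, W. Werner, *Conformal restriction: the chordal case*, JAMS 16
(2003), p. 5 result 2 and Remark 3.8; Ch. Pommerenke, *Boundary Behaviour of Conformal Maps*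
(1992), Thm. 2.6. No new definitions; theorems only.
-/

noncomputable section

open Set Filter Topology MeasureTheory Metric
open Literature.Probability.RandomPlanarGeometry

namespace Summit.CriticalPhenomena.SAWScalingLimit.Theorems.DiscRestriction


/-! ### Two general lemmas -/

/-- The closure of the unit disc Dobrushin domain is the closed unit disc. [folklore] -/
theorem closure_unitDisc_carrier :
    closure (DobrushinDomain.unitDisc).carrier = closedBall (0 : ℂ) 1 := by
  change closure (ball (0 : ℂ) 1) = closedBall 0 1
  exact closure_ball 0 one_ne_zero

/-- **Tietze**: a map continuous on a closed planar set agrees there with a continuous map of the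
plane. [folklore] -/
theorem exists_continuousMap_eqOn {s : Set ℂ} (hs : IsClosed s) {f : ℂ → ℂ}
    (hf : ContinuousOn f s) : ∃ F : C(ℂ, ℂ), EqOn F f s := by
  set f₀ : C(s, ℂ) := ⟨s.restrict f, hf.restrict⟩ with hf₀
  obtain ⟨F, hF⟩ := ContinuousMap.exists_restrict_eq (Y := ℂ) hs f₀
  refine ⟨F, fun w hw ↦ ?_⟩
  have := congrArg (fun g : C(s, ℂ) ↦ g ⟨w, hw⟩) hF
  simpa [hf₀] using this

/-- Two continuous maps of the plane agreeing on the trace of a curve class push it forward to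
the same class. [folklore] -/
theorem curveClassMap_congr {f f' : C(ℂ, ℂ)} {c : CurveClass ℂ} (h : EqOn f f' c.range) :
    CurveClass.map f c = CurveClass.map f' c := by
  obtain ⟨γ, rfl⟩ := CurveClass.surjective_mk c
  rw [CurveClass.map_mk, CurveClass.map_mk]
  congr 1
  refine Curve.ext (ContinuousMap.ext fun t ↦ ?_)
  exact h ⟨t, rfl⟩

/-- Functoriality of the push-forward of curve classes. [folklore] -/
theorem curveClassMap_comp (f g : C(ℂ, ℂ)) (c : CurveClass ℂ) :
    CurveClass.map (g.comp f) c = CurveClass.map g (CurveClass.map f c) := by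
  obtain ⟨γ, rfl⟩ := CurveClass.surjective_mk c
  rfl

/-! ### Transport data: conformal maps of the disc with continuous plane extensions -/

/-- **Transport data.** For every Dobrushin domain `(D; a, b)` there are a conformal equivalence
`g : 𝔻 → D` with boundary values `1 ↦ a`, `-1 ↦ b` and a continuous `G : ℂ → ℂ` with `G = g`
on `𝔻`, `G 1 = a`, `G (-1) = b`, `G` injective on the closed disc and `G(𝔻) ⊆ D`
(Riemann mapping + Carathéodory + Tietze, packaged in the tree as `exists_continuousMap_conj`).
[folklore] -/
theorem exists_transportData (D : DobrushinDomain) :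
    ∃ (g : ConformalEquiv (DobrushinDomain.unitDisc).carrier D.carrier) (G : C(ℂ, ℂ)),
      EqOn G g (DobrushinDomain.unitDisc).carrier ∧
      g.HasBoundaryValue (DobrushinDomain.unitDisc.pt 0) (D.pt 0) ∧
      g.HasBoundaryValue (DobrushinDomain.unitDisc.pt 1) (D.pt 1) ∧
      G (DobrushinDomain.unitDisc.pt 0) = D.pt 0 ∧ G (DobrushinDomain.unitDisc.pt 1) = D.pt 1 ∧
      InjOn G (closure (DobrushinDomain.unitDisc).carrier) ∧
      MapsTo G (DobrushinDomain.unitDisc).carrier D.carrier := by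
  obtain ⟨φ, hφ⟩ := MarkedDomain.exists_isChordalUniformizing_holds DobrushinDomain.unitDisc
  obtain ⟨ψ, hψ⟩ := MarkedDomain.exists_isChordalUniformizing_holds D
  obtain ⟨G, hGg, hb0, hb1, -, hGa, hGb, hGinj, hGD⟩ :=
    exists_continuousMap_conj JordanDomain.exists_continuousOn_extension_holds hφ hψ
  exact ⟨φ.symm.trans ψ, G, hGg, hb0, hb1, hGa, hGb, hGinj, hGD⟩

/-! ### The extension is a homeomorphism of the closed disc onto `closure D` -/

section Inverse

variable {D : DobrushinDomain} {g : ConformalEquiv (DobrushinDomain.unitDisc).carrier D.carrier}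
  {G : C(ℂ, ℂ)}

/-- `G` maps the open disc onto `D`. [folklore] -/
theorem image_carrier_eq (hGg : EqOn G g (DobrushinDomain.unitDisc).carrier) :
    G '' (DobrushinDomain.unitDisc).carrier = D.carrier := by
  rw [hGg.image_eq, g.bijOn.image_eq]

/-- `G` maps the closed disc into `closure D`. [folklore] -/
theorem mapsTo_closure (hGg : EqOn G g (DobrushinDomain.unitDisc).carrier) :
    MapsTo G (closure (DobrushinDomain.unitDisc).carrier) (closure D.carrier) := by
  have h : MapsTo G (DobrushinDomain.unitDisc).carrier D.carrier := by
    rw [← image_carrier_eq hGg]; exact mapsTo_image _ _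
  exact h.closure G.continuous

/-- `G` is a bijection from the closed disc onto `closure D`. [folklore] -/
theorem bijOn_closure (hGg : EqOn G g (DobrushinDomain.unitDisc).carrier)
    (hinj : InjOn G (closure (DobrushinDomain.unitDisc).carrier)) :
    BijOn G (closedBall (0 : ℂ) 1) (closure D.carrier) := by
  rw [← closure_unitDisc_carrier]
  refine ⟨mapsTo_closure hGg, hinj, ?_⟩
  have hclosed : IsClosed (G '' closure (DobrushinDomain.unitDisc).carrier) := by
    rw [closure_unitDisc_carrier]
    exact ((isCompact_closedBall (0 : ℂ) 1).image G.continuous).isClosed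
  have hsub : D.carrier ⊆ G '' closure (DobrushinDomain.unitDisc).carrier := by
    rw [← image_carrier_eq hGg]
    exact image_mono subset_closure
  exact fun w hw ↦ (closure_minimal hsub hclosed) hw

/-- **The inverse homeomorphism.** `G` restricted to the closed disc has a continuous inverse
`Θ` on `closure D` with values in the closed disc. [folklore] -/
theorem exists_inverse (hGg : EqOn G g (DobrushinDomain.unitDisc).carrier)
    (hinj : InjOn G (closure (DobrushinDomain.unitDisc).carrier)) :
    ∃ Θ : ℂ → ℂ, ContinuousOn Θ (closure D.carrier) ∧
      MapsTo Θ (closure D.carrier) (closure (DobrushinDomain.unitDisc).carrier) ∧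
      (∀ ζ ∈ closure (DobrushinDomain.unitDisc).carrier, Θ (G ζ) = ζ) ∧
      (∀ w ∈ closure D.carrier, G (Θ w) = w) ∧
      EqOn Θ g.symm D.carrier ∧ MapsTo Θ D.carrier (DobrushinDomain.unitDisc).carrier := by
  obtain ⟨Θ, hΘc, hΘm, hΘG, hGΘ⟩ := JordanDomain.exists_inverse_extension (D := D.toJordanDomain)
    G.continuous.continuousOn (bijOn_closure hGg hinj)
  rw [← closure_unitDisc_carrier] at hΘm hΘG
  have hsymm : EqOn Θ g.symm D.carrier := by
    intro w hw
    have hz : g.symm w ∈ (DobrushinDomain.unitDisc).carrier := g.symm_mapsTo hw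
    have h1 : Θ (G (g.symm w)) = g.symm w := hΘG _ (subset_closure hz)
    rwa [hGg hz, g.apply_symm_apply hw] at h1
  refine ⟨Θ, hΘc, hΘm, hΘG, hGΘ, hsymm, fun w hw ↦ ?_⟩
  rw [hsymm hw]
  exact g.symm_mapsTo hw

end Inverse

/-! ### The transported family is chordal and carried by simple curves -/

section Family

variable {μ : Measure (CurveClass ℂ)} {G : DobrushinDomain → C(ℂ, ℂ)}

/-- The chordal event of `(D; a, b)` is Borel. [folklore] -/
theorem measurableSet_chordalEvent (D : DobrushinDomain) :
    MeasurableSet {γ : CurveClass ℂ |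
      γ.source = D.pt 0 ∧ γ.target = D.pt 1 ∧ γ.range ⊆ closure D.carrier} :=
  (CurveClass.continuous_source.measurable (measurableSet_singleton _)).inter
    ((CurveClass.continuous_target.measurable (measurableSet_singleton _)).inter
      (CurveClass.measurableSet_rangeSubset isClosed_closure))

/-- The event "simple and touching `∂D` only at the marked points" is Borel. [folklore] -/
theorem measurableSet_simpleEvent (D : DobrushinDomain) :
    MeasurableSet {γ : CurveClass ℂ |
      γ ∈ CurveClass.simple ∧ γ.range ∩ frontier D.carrier ⊆ {D.pt 0, D.pt 1}} := by
  have h₉ : CurveClass.measurableSet_simple (E := ℂ) := CurveClass.measurableSet_simple_holds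
  exact MeasurableSet.inter h₉ (CurveClass.measurableSet_range_inter_subset isClosed_frontier
    ((isClosed_singleton (x := D.pt 0)).union (isClosed_singleton (x := D.pt 1))))

/-- **The transported family is chordal**: if `μ` is a probability law carried by curves of the
closed disc from `1` to `-1` and each `G D` sends `1 ↦ a`, `-1 ↦ b`, `𝔻 → D`, then
`D ↦ (G D)_* μ` is a chordal family. [folklore] -/
theorem isChordal_transport [IsProbabilityMeasure μ]
    (hμ : ∀ᵐ γ ∂μ, γ.source = DobrushinDomain.unitDisc.pt 0 ∧
      γ.target = DobrushinDomain.unitDisc.pt 1 ∧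
      γ.range ⊆ closure (DobrushinDomain.unitDisc).carrier)
    (hG0 : ∀ D, G D (DobrushinDomain.unitDisc.pt 0) = D.pt 0)
    (hG1 : ∀ D, G D (DobrushinDomain.unitDisc.pt 1) = D.pt 1)
    (hGcl : ∀ D : DobrushinDomain,
      MapsTo (G D) (closure (DobrushinDomain.unitDisc).carrier) (closure D.carrier)) :
    ChordalFamily.IsChordal (fun D ↦ μ.map (CurveClass.map (G D))) := by
  intro D
  refine ⟨Measure.isProbabilityMeasure_map (CurveClass.measurable_map _).aemeasurable, ?_⟩
  change ∀ᵐ γ ∂(μ.map (CurveClass.map (G D))), _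
  rw [ae_map_iff (CurveClass.measurable_map _).aemeasurable (measurableSet_chordalEvent D)]
  filter_upwards [hμ] with γ ⟨hs, ht, hr⟩
  refine ⟨?_, ?_, ?_⟩
  · rw [CurveClass.source_map, hs, hG0]
  · rw [CurveClass.target_map, ht, hG1]
  · rw [CurveClass.range_map]
    exact (image_mono hr).trans (hGcl D).image_subset

/-- Curves of the closed disc from `1` to `-1`, simple and touching the circle only at `±1`, lie
in the chordal carrier of `(𝔻; 1, -1)`. [folklore] -/
theorem mem_chordalCarrier_unitDisc {γ : CurveClass ℂ}
    (h1 : γ.source = DobrushinDomain.unitDisc.pt 0 ∧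
      γ.target = DobrushinDomain.unitDisc.pt 1 ∧
      γ.range ⊆ closure (DobrushinDomain.unitDisc).carrier)
    (h2 : γ ∈ CurveClass.simple ∧ γ.range ∩ frontier (DobrushinDomain.unitDisc).carrier ⊆
      {DobrushinDomain.unitDisc.pt 0, DobrushinDomain.unitDisc.pt 1}) :
    γ ∈ chordalCarrier DobrushinDomain.unitDisc := by
  obtain ⟨hs, ht, hr⟩ := h1
  obtain ⟨hsim, hfr⟩ := h2
  refine ⟨⟨⟨hsim, hs⟩, ht⟩, fun w hw ↦ ?_⟩
  have hw' := hr hw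
  rw [closure_eq_self_union_frontier] at hw'
  rcases hw' with h | h
  · exact Or.inl h
  · exact Or.inr (hfr ⟨hw, h⟩)

/-- **The transported family is carried by simple curves**: `G D`, injective on the closed disc,
maps chordal simple curves of `(𝔻; 1, -1)` to chordal simple curves of `(D; a, b)`
(`map_mem_chordalCarrier`). [folklore] -/
theorem isCarriedBySimpleCurves_transport
    (hμ : ∀ᵐ γ ∂μ, γ.source = DobrushinDomain.unitDisc.pt 0 ∧
      γ.target = DobrushinDomain.unitDisc.pt 1 ∧
      γ.range ⊆ closure (DobrushinDomain.unitDisc).carrier)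
    (hμs : ∀ᵐ γ ∂μ, γ ∈ CurveClass.simple ∧
      γ.range ∩ frontier (DobrushinDomain.unitDisc).carrier ⊆
        {DobrushinDomain.unitDisc.pt 0, DobrushinDomain.unitDisc.pt 1})
    (hG0 : ∀ D, G D (DobrushinDomain.unitDisc.pt 0) = D.pt 0)
    (hG1 : ∀ D, G D (DobrushinDomain.unitDisc.pt 1) = D.pt 1)
    (hinj : ∀ D : DobrushinDomain, InjOn (G D) (closure (DobrushinDomain.unitDisc).carrier))
    (hmaps : ∀ D : DobrushinDomain, MapsTo (G D) (DobrushinDomain.unitDisc).carrier D.carrier) :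
    ChordalFamily.IsCarriedBySimpleCurves (fun D ↦ μ.map (CurveClass.map (G D))) := by
  intro D
  change ∀ᵐ γ ∂(μ.map (CurveClass.map (G D))), _
  rw [ae_map_iff (CurveClass.measurable_map _).aemeasurable (measurableSet_simpleEvent D)]
  filter_upwards [hμ, hμs] with γ h1 h2
  have hc := map_mem_chordalCarrier (hinj D) (hmaps D) (hG0 D) (hG1 D)
    (mem_chordalCarrier_unitDisc h1 h2)
  refine ⟨hc.1.1.1, ?_⟩
  rintro w ⟨hw, hwfr⟩
  rcases hc.2 hw with h | h
  · exfalso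
    rw [D.isOpen.frontier_eq] at hwfr
    exact hwfr.2 h
  · exact h

end Family

/-! ### Conformal covariance of the transported family -/

section Covariance

/-- A conformal automorphism of the unit disc agrees on the disc with a continuous map of the
plane (Carathéodory for the disc onto itself, then Tietze). [folklore] -/
theorem exists_continuousMap_eqOn_automorphism
    (k : ConformalEquiv (DobrushinDomain.unitDisc).carrier (DobrushinDomain.unitDisc).carrier) :
    ∃ K : C(ℂ, ℂ), EqOn K k (DobrushinDomain.unitDisc).carrier := by
  obtain ⟨Ψ, hΨc, hΨeq, -, -⟩ :=
    JordanDomain.exists_continuousOn_extension_holds JordanDomain.unitDisc k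
  obtain ⟨K, hK⟩ := exists_continuousMap_eqOn isClosed_closedBall hΨc
  exact ⟨K, fun z hz ↦ (hK (ball_subset_closedBall hz)).trans (hΨeq hz)⟩

variable {μ : Measure (CurveClass ℂ)}
  {g : ∀ D : DobrushinDomain, ConformalEquiv (DobrushinDomain.unitDisc).carrier D.carrier}
  {G : DobrushinDomain → C(ℂ, ℂ)} {Θ : DobrushinDomain → ℂ → ℂ}

/-- **Inverse boundary values.** If `Θ D` is continuous on `closure D`, inverts `G D` on the
closed disc and agrees with `(g D)⁻¹` on `D`, then `(g D)⁻¹` tends to `±1` at the marked points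
`a`, `b` within `D`. [folklore] -/
theorem tendsto_symm_pt {D : DobrushinDomain} (hΘc : ContinuousOn (Θ D) (closure D.carrier))
    (hΘG : ∀ ζ ∈ closure (DobrushinDomain.unitDisc).carrier, Θ D (G D ζ) = ζ)
    (hΘsymm : EqOn (Θ D) (g D).symm D.carrier)
    (hG : ∀ i : Fin 2, G D (DobrushinDomain.unitDisc.pt i) = D.pt i) (i : Fin 2) :
    Tendsto (g D).symm (𝓝[D.carrier] (D.pt i)) (𝓝 (DobrushinDomain.unitDisc.pt i)) := by
  have hx : D.pt i ∈ closure D.carrier := frontier_subset_closure (D.pt_mem_frontier i)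
  have h1 : Tendsto (Θ D) (𝓝[closure D.carrier] (D.pt i)) (𝓝 (Θ D (D.pt i))) := hΘc _ hx
  have h2 : Θ D (D.pt i) = DobrushinDomain.unitDisc.pt i := by
    rw [← hG i]
    exact hΘG _ (frontier_subset_closure (DobrushinDomain.unitDisc.pt_mem_frontier i))
  rw [h2] at h1
  exact (h1.mono_left (nhdsWithin_mono _ subset_closure)).congr'
    (eventually_nhdsWithin_of_forall fun w hw ↦ hΘsymm hw)

/-- A conformal equivalence with a boundary value tends to it WITHIN the target. [folklore] -/
theorem tendsto_nhdsWithin_of_hasBoundaryValue {U V : Set ℂ} (φ : ConformalEquiv U V) {x p : ℂ}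
    (h : φ.HasBoundaryValue x p) : Tendsto φ (𝓝[U] x) (𝓝[V] p) :=
  tendsto_nhdsWithin_iff.2 ⟨h, eventually_nhdsWithin_of_forall fun _ hz ↦ φ.mapsTo hz⟩

/-- **Conformal covariance of the transported family.** If `μ` (carried by the closed disc) is
invariant under the automorphisms of `(𝔻; 1, -1)` pushed along continuous extensions, then
`D ↦ (G D)_* μ` is conformally covariant: for `h : D → D'` respecting the marked points,
`k = g_{D'}⁻¹ ∘ h ∘ g_D` is such an automorphism, and `G_{D'} ∘ K = Φ ∘ G_D` on the closed
disc for any continuous extensions `K` of `k` and `Φ` of `h`. [folklore] -/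
theorem isConformallyCovariant_transport
    (hμ : ∀ᵐ γ ∂μ, γ.range ⊆ closure (DobrushinDomain.unitDisc).carrier)
    (hInv : ∀ (k : ConformalEquiv (DobrushinDomain.unitDisc).carrier
        (DobrushinDomain.unitDisc).carrier) (K : C(ℂ, ℂ)),
      k.HasBoundaryValue (DobrushinDomain.unitDisc.pt 0) (DobrushinDomain.unitDisc.pt 0) →
      k.HasBoundaryValue (DobrushinDomain.unitDisc.pt 1) (DobrushinDomain.unitDisc.pt 1) →
      EqOn K k (DobrushinDomain.unitDisc).carrier → μ.map (CurveClass.map K) = μ)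
    (hGg : ∀ D, EqOn (G D) (g D) (DobrushinDomain.unitDisc).carrier)
    (hb : ∀ D (i : Fin 2), (g D).HasBoundaryValue (DobrushinDomain.unitDisc.pt i) (D.pt i))
    (hG : ∀ D (i : Fin 2), G D (DobrushinDomain.unitDisc.pt i) = D.pt i)
    (hΘc : ∀ D : DobrushinDomain, ContinuousOn (Θ D) (closure D.carrier))
    (hΘG : ∀ D, ∀ ζ ∈ closure (DobrushinDomain.unitDisc).carrier, Θ D (G D ζ) = ζ)
    (hΘsymm : ∀ D : DobrushinDomain, EqOn (Θ D) (g D).symm D.carrier) :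
    ChordalFamily.IsConformallyCovariant (fun D ↦ μ.map (CurveClass.map (G D))) := by
  intro D D' h Φ h0 h1 hΦ
  change μ.map (CurveClass.map (G D')) = (μ.map (CurveClass.map (G D))).map (CurveClass.map Φ)
  -- the automorphism `k = g_{D'}⁻¹ ∘ h ∘ g_D` of the disc and its boundary values
  set k : ConformalEquiv (DobrushinDomain.unitDisc).carrier (DobrushinDomain.unitDisc).carrier :=
    ((g D).trans h).trans (g D').symm with hk
  have hkb : ∀ i : Fin 2, (i = 0 → h.HasBoundaryValue (D.pt i) (D'.pt i)) →
      (i = 1 → h.HasBoundaryValue (D.pt i) (D'.pt i)) →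
      k.HasBoundaryValue (DobrushinDomain.unitDisc.pt i) (DobrushinDomain.unitDisc.pt i) := by
    intro i hi0 hi1
    have hh : h.HasBoundaryValue (D.pt i) (D'.pt i) := by
      fin_cases i
      · exact hi0 rfl
      · exact hi1 rfl
    have t1 := tendsto_nhdsWithin_of_hasBoundaryValue (g D) (hb D i)
    have t2 := tendsto_nhdsWithin_of_hasBoundaryValue h hh
    have t3 := tendsto_symm_pt (hΘc D') (hΘG D') (hΘsymm D') (hG D') i
    exact (t3.comp t2).comp t1
  have hk0 : k.HasBoundaryValue (DobrushinDomain.unitDisc.pt 0) (DobrushinDomain.unitDisc.pt 0) :=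
    hkb 0 (fun _ ↦ h0) (fun h ↦ by simp at h)
  have hk1 : k.HasBoundaryValue (DobrushinDomain.unitDisc.pt 1) (DobrushinDomain.unitDisc.pt 1) :=
    hkb 1 (fun h ↦ by simp at h) (fun _ ↦ h1)
  obtain ⟨K, hK⟩ := exists_continuousMap_eqOn_automorphism k
  -- `G_{D'} ∘ K = Φ ∘ G_D` on the closed disc
  have heq : EqOn ((G D').comp K) (Φ.comp (G D)) (closure (DobrushinDomain.unitDisc).carrier) := by
    refine EqOn.closure (fun z hz ↦ ?_) ((G D').comp K).continuous (Φ.comp (G D)).continuous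
    have hkz : k z ∈ (DobrushinDomain.unitDisc).carrier := k.mapsTo hz
    have hgz : g D z ∈ D.carrier := (g D).mapsTo hz
    have hhz : h (g D z) ∈ D'.carrier := h.mapsTo hgz
    rw [ContinuousMap.comp_apply, ContinuousMap.comp_apply, hK hz, hGg D' hkz, hGg D hz, hΦ hgz]
    change (g D') ((g D').symm (h (g D z))) = h (g D z)
    exact (g D').apply_symm_apply hhz
  -- conclude
  rw [Measure.map_map (CurveClass.measurable_map _) (CurveClass.measurable_map _),
    ← hInv k K hk0 hk1 hK,
    Measure.map_map (CurveClass.measurable_map _) (CurveClass.measurable_map _),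
    hInv k K hk0 hk1 hK]
  refine Measure.map_congr ?_
  filter_upwards [hμ] with γ hγ
  rw [Function.comp_apply, Function.comp_apply, ← curveClassMap_comp, ← curveClassMap_comp]
  exact curveClassMap_congr (heq.mono hγ)

end Covariance

end Summit.CriticalPhenomena.SAWScalingLimit.Theorems.DiscRestriction

end
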